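/-
Copyright: H21 programme, solo seat `solo-RiemannHypothesis-informed` (session 4).
-/
import Summits.RiemannHypothesis.RiemannHypothesis.Theorems.SoloInformedEffDoubleLog
import Summits.RiemannHypothesis.RiemannHypothesis.Theorems.SoloInformedDoubleLogMain
import Summits.RiemannHypothesis.RiemannHypothesis.Theorems.SoloInformedDensityExplicit

/-!
# Effective main statements (solo-informed, T23)

T18 and T20 with the definite offset `c₀(η) = doubleLogC0 ψ₁ |η|` (`ψ₁ = windowPlateau 1`), and
the absolute bound `bumpK ψ ≤ 108000·(‖ψ″‖₁² + ‖ψ‴‖₁² + 2‖ψ⁗‖₁²) + 1` under the named fact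
`zetaZeroCount_hasanalizade_shen_wong` (T22). What remains numerically open in `c₀(η)` are the
four numbers `‖ψ₁⁽ʲ⁾‖₁` (`j = 2,3,4`) and `Φ₁(±|η|)` of the fixed bump `ψ₁`.
-/

open MeasureTheory Complex Set Filter Topology Literature.NumberTheory.LFunctions
open scoped ContDiff ComplexConjugate

namespace Summit.RiemannHypothesis.RiemannHypothesis.Theorems

/-- **T18, effective.** Double-log visibility of a fixed-offset zero with the definite offset
`doubleLogC0 (windowPlateau 1) |η|`. -/
theorem weilGroundEnergy_neg_of_local_doubleLog_offset_eff {η : ℝ} (hη0 : η ≠ 0)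
    (hη : |η| < 1 / 2) :
    ∀ (γ₀ c R : ℝ), 1 ≤ |γ₀| →
      doubleLogC0 (windowPlateau 1) |η| + Real.log (Real.log (|γ₀| + 2)) / (2 * |η|) ≤ c →
      1 ≤ R → Real.exp (c + 1) ≤ R ^ 2 →
      riemannZeta (1 / 2 + η + γ₀ * I) = 0 →
      (∀ ρ : ℂ, riemannZeta ρ = 0 → 0 ≤ ρ.re → ρ.re ≤ 1 → |ρ.im - γ₀| < R → ρ.re ≠ 1 / 2 →
          ρ = 1 / 2 + ↑|η| + γ₀ * I ∨ ρ = 1 / 2 - ↑|η| + γ₀ * I) →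
      weilGroundEnergy (c + 1) < 0 := by
  have hpos : 0 < |η| := abs_pos.mpr hη0
  have hT := weilGroundEnergy_neg_of_local_doubleLog_eff (ψ := windowPlateau 1)
    (contDiff_windowPlateau 1) (tsupport_windowPlateau_subset 1) (windowPlateau_nonneg 1) hpos hη
    (bumpLaplace_windowPlateau_one_pos |η|)
  intro γ₀ c R hγ hc hR hRa hζ hloc
  refine hT γ₀ c R hγ hc hR hRa ?_ hloc
  rcases le_or_gt 0 η with h | h
  · rw [abs_of_nonneg h]; exact hζ
  · rw [abs_of_neg h]
    push_cast
    rw [show (1 / 2 + -(η : ℂ) + γ₀ * I) = 1 / 2 - η + γ₀ * I by ring]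
    exact riemannZeta_zero_reflect hη hζ

/-- **T20, effective.** Weil positivity at the definite double-log window plus local RH up to the
pair excludes the zero. -/
theorem riemannZeta_ne_zero_of_local_of_weilGroundEnergy_nonneg_eff {η : ℝ} (hη0 : η ≠ 0)
    (hη : |η| < 1 / 2) :
    ∀ (γ₀ c R : ℝ), 1 ≤ |γ₀| →
      doubleLogC0 (windowPlateau 1) |η| + Real.log (Real.log (|γ₀| + 2)) / (2 * |η|) ≤ c →
      1 ≤ R → Real.exp (c + 1) ≤ R ^ 2 →
      (∀ ρ : ℂ, riemannZeta ρ = 0 → 0 ≤ ρ.re → ρ.re ≤ 1 → |ρ.im - γ₀| < R → ρ.re ≠ 1 / 2 →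
          ρ = 1 / 2 + ↑|η| + γ₀ * I ∨ ρ = 1 / 2 - ↑|η| + γ₀ * I) →
      0 ≤ weilGroundEnergy (c + 1) →
      riemannZeta (1 / 2 + η + γ₀ * I) ≠ 0 := by
  intro γ₀ c R hγ hc hR hRc hloc hpos hζ
  have := weilGroundEnergy_neg_of_local_doubleLog_offset_eff hη0 hη γ₀ c R hγ hc hR hRc hζ hloc
  linarith

/-- **T20, effective, both members.** Under the same hypotheses RH holds throughout the window
`|Im ρ − γ₀| < R` of the closed strip. -/
theorem local_rh_of_local_upto_pair_of_weilGroundEnergy_nonneg_eff {η : ℝ} (hη0 : η ≠ 0)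
    (hη : |η| < 1 / 2) :
    ∀ (γ₀ c R : ℝ), 1 ≤ |γ₀| →
      doubleLogC0 (windowPlateau 1) |η| + Real.log (Real.log (|γ₀| + 2)) / (2 * |η|) ≤ c →
      1 ≤ R → Real.exp (c + 1) ≤ R ^ 2 →
      (∀ ρ : ℂ, riemannZeta ρ = 0 → 0 ≤ ρ.re → ρ.re ≤ 1 → |ρ.im - γ₀| < R → ρ.re ≠ 1 / 2 →
          ρ = 1 / 2 + ↑|η| + γ₀ * I ∨ ρ = 1 / 2 - ↑|η| + γ₀ * I) →
      0 ≤ weilGroundEnergy (c + 1) →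
      ∀ ρ : ℂ, riemannZeta ρ = 0 → 0 ≤ ρ.re → ρ.re ≤ 1 → |ρ.im - γ₀| < R → ρ.re = 1 / 2 := by
  have hpos : 0 < |η| := abs_pos.mpr hη0
  have hA : |(|η|)| < 1 / 2 := by rwa [abs_abs]
  have hB : |(-|η|)| < 1 / 2 := by rwa [abs_neg, abs_abs]
  have h₁ := riemannZeta_ne_zero_of_local_of_weilGroundEnergy_nonneg_eff hpos.ne' hA
  have h₂ := riemannZeta_ne_zero_of_local_of_weilGroundEnergy_nonneg_eff
    (neg_ne_zero.mpr hpos.ne') hB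
  intro γ₀ c R hγ hc hR hRc hloc hE ρ hζ h0 h1 hd
  have e1 : |(|η|)| = |η| := abs_abs η
  have e2 : |(-|η|)| = |η| := by rw [abs_neg, abs_abs]
  have hloc1 : ∀ ρ : ℂ, riemannZeta ρ = 0 → 0 ≤ ρ.re → ρ.re ≤ 1 → |ρ.im - γ₀| < R →
      ρ.re ≠ 1 / 2 → ρ = 1 / 2 + ↑|(|η|)| + γ₀ * I ∨ ρ = 1 / 2 - ↑|(|η|)| + γ₀ * I := by
    rw [e1]; exact hloc
  have hloc2 : ∀ ρ : ℂ, riemannZeta ρ = 0 → 0 ≤ ρ.re → ρ.re ≤ 1 → |ρ.im - γ₀| < R →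
      ρ.re ≠ 1 / 2 → ρ = 1 / 2 + ↑|(-|η|)| + γ₀ * I ∨ ρ = 1 / 2 - ↑|(-|η|)| + γ₀ * I := by
    rw [e2]; exact hloc
  have hc1 : doubleLogC0 (windowPlateau 1) |(|η|)|
      + Real.log (Real.log (|γ₀| + 2)) / (2 * |(|η|)|) ≤ c := by rw [e1]; exact hc
  have hc2 : doubleLogC0 (windowPlateau 1) |(-|η|)|
      + Real.log (Real.log (|γ₀| + 2)) / (2 * |(-|η|)|) ≤ c := by rw [e2]; exact hc
  have n₁ := h₁ γ₀ c R hγ hc1 hR hRc hloc1 hE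
  have n₂ := h₂ γ₀ c R hγ hc2 hR hRc hloc2 hE
  by_contra hne
  rcases hloc ρ hζ h0 h1 hd hne with rfl | rfl
  · exact n₁ hζ
  · apply n₂
    push_cast
    rw [show (1 / 2 + -((|η| : ℝ) : ℂ) + γ₀ * I) = 1 / 2 - ((|η| : ℝ) : ℂ) + γ₀ * I by ring]
    exact hζ

/-- **The constant is a number** (conditional on the explicit zero count of
Hasanalizade–Shen–Wong, taken as a hypothesis):
`bumpK ψ ≤ 108000·(‖ψ″‖₁² + ‖ψ‴‖₁² + 2‖ψ⁗‖₁²) + 1`. -/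
theorem bumpK_le_of_hsw (h : zetaZeroCount_hasanalizade_shen_wong) (ψ : ℝ → ℝ) :
    bumpK ψ ≤ 108000 * ((∫ s, |iteratedDeriv 2 ψ s|) ^ 2 + (∫ s, |iteratedDeriv 3 ψ s|) ^ 2
      + 2 * (∫ s, |iteratedDeriv 4 ψ s|) ^ 2) + 1 := by
  unfold bumpK
  have h1 := zetaDensityConst_le_of_hsw h
  have h2 : 0 ≤ (∫ s, |iteratedDeriv 2 ψ s|) ^ 2 + (∫ s, |iteratedDeriv 3 ψ s|) ^ 2
      + 2 * (∫ s, |iteratedDeriv 4 ψ s|) ^ 2 := by positivity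
  nlinarith [mul_le_mul_of_nonneg_right h1 h2]

end Summit.RiemannHypothesis.RiemannHypothesis.Theorems
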